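import Summits.ResolutionOfSingularities.ResolutionOfSingularities.Theorems.EquisingularLiftEquisingularLiftNatTowerBPairRoundOfFact
import Summits.ResolutionOfSingularities.ResolutionOfSingularities.Theorems.EquisingularLiftEquisingularLiftNatBoundaryWitnessedCentre
import Summits.ResolutionOfSingularities.ResolutionOfSingularities.Theorems.EquisingularLiftEquisingularLiftNatNestedSectionInModels
import Literature.AlgebraicGeometry.Resolution.AlterationsStrictTransformModel
import HarnessLib

/-!
# [OURS · L1 W4.5(b) · EL♮(3) · WIDTH TABLE D17 «STAGE-0 TOWER BOOKKEEPING», engine brick (n2b)] THE JOINT SECTION ON TWO TRANSVERSALLY CROSSING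
# MEMBER MODELS — `Tower.exists_joint_section_of_coneWitness`

res-L1-w45b-lead-2 g10 (text owner of the crux chain; brick (n2b) offered 2026-08-29T12:52:10Z for res-L1-w45b-stub-4 g16's `(pt-reg)` closure
`Tower.invB₄_ptRegStep₅` of the re-typed letter `TowerPtRegB₅` (desk RULING R83, E9′ «≤ 2» form: two designated through-members `F₀`, `F₀'` crossing in
PAIR-ROUND currency). Crux EL♮(3) = stmt-ResolutionOfSingularities-20148 (parent EL♮ stmt-…-20038), route `EquisingularLift`, line `sections`. OURS; NOT a
statement of any manuscript ([Hironaka2017] is a candidate under adjudication, nothing of it is asserted); AI-written, weaker than expert review. DEF-FREE;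
no `sorry`; standard axioms. `--supports stmt-ResolutionOfSingularities-20148 --as helper`, counted 0. EL♮(3) is NOT proved by this file.

WHAT. At an upstairs stage `(X, σ)` with model square `jG : G → X` over `Spec θ`, two MODEL-CARRYING members `H`, `W` of the special fibre (models `𝓔`, `𝓦`:
exact reduced traces, stalkwise principal, regular, off the generic point of `Y`, `O`-flat — the `Exc₄` clauses at the datum `FE`) crossing REDUCEDLY along
`Z` (`ConeWitness G H hH W Z hZ`: `Z = H ∩ W` and `𝓘⟨H⟩ ⊔ 𝓘⟨W⟩ = 𝓘⟨Z⟩`) with `Z̃` regular and one-dimensional at its closed points — the PAIR-round currency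
of ✓ `Tower.invB₄_pairRound_of_fact` — and a CLOSED point `y ∈ Z`: there is a section `ỹ : Spec O → X` of `σ ≫ q` through `jG y` LYING ON BOTH MODELS,
`𝓔 ≤ ker ỹ` and `𝓦 ≤ ker ỹ` (a closed immersion with regular centre `V(ker ỹ)`, `supp (ker ỹ) = range ỹ`, `ỹ(𝔪)` closed).  So the point step at `y` can
blow up `ker ỹ` and transport BOTH members through the point model-carrying (res-L1-w45b-stub-4's (n1) `Tower.exc₄_transport_through`, input `𝓕 ≤ ker ỹ`).

PROOF = composition of tree theorems, no new local algebra: the joint model `V(𝓔 ⊔ 𝓦)` has exact reduced trace `Z̃`, is `O`-FLAT and REGULAR by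
✓ `Tower.hPair_of_coneWitness` (res-L1-w45b-stub-2, …NatTowerBPairRoundOfFact) fed with the ✓ (A″-1)/(A″-2) bricks `isRegular_subscheme_sup_of_trace_crossing` /
`flat_subschemeι_sup_of_trace_crossing` (res-L1-w45b-lead-1 / res-L1-w45b-stub-2, …NatBoundaryWitnessedCentre); its special fibre `V((𝓔 ⊔ 𝓦)·𝒪_G) → V(𝓔 ⊔ 𝓦)`
is a model square (`isPullback_of_isClosedImmersion` pasted with `hsq`, as in res-L1-w45b-stub-4's ✓ HPT `TCPlus.hostedPointStep_of_letterDatum`); the Hensel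
section NESTED in `V(𝓔 ⊔ 𝓦)` is ✓ `exists_nested_section_closedImmersion` (res-L1-w45b-lead-1, …NatNestedSectionInModels; EGA IV 18.5.17 form) at the point of
`Z̃` over `y` (regular because `Z̃` is); `𝓔 ⊔ 𝓦 ≤ ker ỹ` by `IsClosedImmersion.ker_le_ker_of_range_subset`.
[cite: Grothendieck1967, Thm. 18.5.17] [cite: Matsumura1987, Thm. 14.2] [cite: Liu2002, Thm. 8.1.19] (through the cited tree files).
-/

set_option linter.dupNamespace false -- mandated namespace `Summit.<Summit>.<Problem>` of this single-conjunct summit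
set_option linter.overlappingInstances false -- signatures carry `[IsDomain O] [IsDiscreteValuationRing O]`

noncomputable section

open CategoryTheory CategoryTheory.Limits AlgebraicGeometry TopologicalSpace Topology IsLocalRing
open Literature.AlgebraicGeometry.Resolution
open AlgebraicGeometry.Scheme.IdealSheafData
open Summit.ResolutionOfSingularities.ResolutionOfSingularities.Theses.EquisingularLift.Split
open Summit.ResolutionOfSingularities.ResolutionOfSingularities.Cruxes.EquisingularLift.StrataSplit

namespace Summit.ResolutionOfSingularities.ResolutionOfSingularities.Cruxes.EquisingularLiftNat.Sections

section JointSection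

variable (O : Type) [CommRing O] [IsDomain O] [IsDiscreteValuationRing O] [IsAdicComplete (IsLocalRing.maximalIdeal O) O]
    [IsAlgClosed (IsLocalRing.ResidueField O)] (k : Type) [Field k]
    (θ : O →+* k) (hθ : Function.Surjective θ)
    (P : Scheme.{0}) [IsIntegral P] (q : P ⟶ Spec (.of O)) [IsProper q] [SmoothOfRelativeDimension 3 q] (Y : Set P)
    (hYirr : IsIrreducible Y) (hYcl : IsClosed Y)
    (hPnoeth : IsLocallyNoetherian P) (hPreg : Scheme.IsRegular P)
    (Ch : ∀ X' : Scheme.{0}, (X' ⟶ P) → Set X' → Prop)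
    (hChSplit : ∀ (X' : Scheme.{0}) (σ' : X' ⟶ P) (S' : Set X'), Ch X' σ' S' → Chain P Y X' σ' S')

include hθ hYirr hYcl hPnoeth hPreg hChSplit

/-- ★ **(n2b) THE JOINT SECTION ON TWO TRANSVERSALLY CROSSING MEMBER MODELS.** At a `Ch`-stage `(X, σ, S)` with model square `jG` over `Spec θ`, two
model-carrying members `H`, `W` (`Exc₄` clauses at `FE` for their models `𝓔`, `𝓦`; neither contains `T`) crossing reducedly along `Z`
(`ConeWitness G H hH W Z hZ`) with `Z̃` regular and one-dimensional at its closed points, and a closed point `y ∈ Z`: a section `ỹ` of `σ ≫ q` through `jG y`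
with `𝓔 ≤ ker ỹ` and `𝓦 ≤ ker ỹ` — a closed immersion, `V(ker ỹ)` regular, `supp (ker ỹ) = range ỹ`, `ỹ(𝔪)` closed. [cite: Grothendieck1967, Thm. 18.5.17]
[cite: Matsumura1987, Thm. 14.2] [OURS · L1 W4.5b · D17 engine brick (n2b), for res-L1-w45b-stub-4's `Tower.invB₄_ptRegStep₅`]; NOT a statement of the
manuscript; EL♮(3) NOT proved. -/
theorem Tower.exists_joint_section_of_coneWitness
    {F₉ : Scheme.{0}} (Z₉ : Set F₉) (hZ₉ : IsClosed Z₉) {F₁₀ : Scheme.{0}} (υ' : F₁₀ ⟶ F₉)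
    (G : Scheme.{0}) (γ : G ⟶ F₁₀) (T H : Set G) (hH : IsClosed H) (Z : Set G) (hZ : IsClosed Z) (W : Set G) (hW : IsClosed W)
    (hTH : ¬ T ⊆ H) (hpair : ConeWitness G H hH W Z hZ)
    (hZreg : ∀ x : redSub G Z hZ, IsRegularLocalRing ((redSub G Z hZ).presheaf.stalk x))
    (hZdim : ∀ z : ↥(redSub G Z hZ), IsClosed ({z} : Set ↥(redSub G Z hZ)) →
      ringKrullDim ((redSub G Z hZ).presheaf.stalk z) = ((1 : ℕ) : WithBot ℕ∞))
    (X : Scheme.{0}) (σ : X ⟶ P) (S : Set X) (jG : G ⟶ X) (tG : G ⟶ Spec (.of k))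
    (hCh : Ch X σ S) (hXint : IsIntegral X) (hXnoeth : IsLocallyNoetherian X) (hXreg : Scheme.IsRegular X) (hdom : IsDominant (σ ≫ q))
    (hsq : IsPullback jG tG (σ ≫ q) (Spec.map (CommRingCat.ofHom θ))) (hTS : jG '' T = S)
    (𝓔 𝓦 : X.IdealSheafData)
    (he_i : 𝓔.comap jG = vanishingIdeal ⟨H, hH⟩) (he_ii : ∀ z : X, (stalkIdeal 𝓔 z).IsPrincipal) (he_iii : Scheme.IsRegular 𝓔.subscheme)
    (he_iv : σ '' (𝓔.support : Set X) ⊆ {p : P | ¬ IsGenericPoint p Y}) (hFE_E : Flat (𝓔.subschemeι ≫ σ ≫ q))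
    (hw_i : 𝓦.comap jG = vanishingIdeal ⟨W, hW⟩) (hw_ii : ∀ z : X, (stalkIdeal 𝓦 z).IsPrincipal) (hw_iii : Scheme.IsRegular 𝓦.subscheme)
    (hw_iv : σ '' (𝓦.support : Set X) ⊆ {p : P | ¬ IsGenericPoint p Y}) (hFE_W : Flat (𝓦.subschemeι ≫ σ ≫ q)) (hTW : ¬ T ⊆ W)
    (y : G) (hyZ : y ∈ Z) (hyc : IsClosed ({y} : Set G)) :
    ∃ s : Spec (.of O) ⟶ X, s ≫ σ ≫ q = 𝟙 _ ∧ s (IsLocalRing.closedPoint O) = jG y ∧ IsClosedImmersion s ∧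
      Scheme.IsRegular s.ker.subscheme ∧ 𝓔 ≤ s.ker ∧ 𝓦 ≤ s.ker ∧
      (s.ker.support : Set X) = Set.range s.base ∧ IsClosed ({s (IsLocalRing.closedPoint O)} : Set X) := by
  classical
  haveI := hXint
  haveI := hXnoeth
  -- properness of the stage (for the separatedness of `V(𝓔 ⊔ 𝓦) → Spec O`)
  obtain ⟨-, -, hσ⟩ := chain_isRegular P Y X σ S (hChSplit _ _ _ hCh) hPnoeth hPreg
  haveI := hσ
  haveI : IsProper (σ ≫ q) := inferInstance
  -- (1) the joint model `V(𝓔 ⊔ 𝓦)`: exact reduced trace `Z̃`, `O`-flat, regular — pair-round currency, ✓ bricks (A″-1)/(A″-2)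
  obtain ⟨hc1, hc2, hc3, -, -, -⟩ :=
    Tower.hPair_of_coneWitness O k θ hθ P q Y hYirr hYcl hPnoeth hPreg Ch hChSplit
      (fun {_ _} _ {_ _ _ _ _ _ _ _ _} hXreg' hsq' hθ' hprop hE1 hE2 hF1 hF2 hW1 hW2 hWdim => by
        haveI := hprop
        exact isRegular_subscheme_sup_of_trace_crossing hXreg' hsq' hθ' hE1 hE2 hF1 hF2 hW1 hW2 hWdim)
      (fun {_ _} _ {_ _ _ _ _ _ _ _ _} hXreg' hsq' hθ' hprop hE1 hE2 hF1 hF2 hW1 hW2 hWdim => by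
        haveI := hprop
        exact flat_subschemeι_sup_of_trace_crossing hXreg' hsq' hθ' hE1 hE2 hF1 hF2 hW1 hW2 hWdim)
      Z₉ hZ₉ υ' G γ T H hH Z hZ W hW hTH hpair hZreg hZdim X σ S jG tG hCh hXint hXnoeth hXreg hdom hsq hTS 𝓔 𝓦
      he_i he_ii he_iii he_iv hFE_E hw_i hw_ii hw_iii hw_iv hFE_W hTW
  -- (2) the special fibre `V((𝓔 ⊔ 𝓦)·𝒪_G) → V(𝓔 ⊔ 𝓦)` as a model square
  let 𝓛 : X.IdealSheafData := 𝓔 ⊔ 𝓦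
  let ιW := 𝓛.subschemeι
  let iX := (𝓛.comap jG).subschemeι
  let jW : (𝓛.comap jG).subscheme ⟶ 𝓛.subscheme := Scheme.IdealSheafData.subschemeMap (𝓛.comap jG) 𝓛 jG (𝓛.le_map_comap jG)
  have hjW : jW ≫ ιW = iX ≫ jG := Scheme.IdealSheafData.subschemeMap_subschemeι _ _ _ _
  have hsq1 : IsPullback iX jW jG ιW :=
    isPullback_of_isClosedImmersion iX ιW jW jG hjW.symm
      (by rw [Scheme.IdealSheafData.ker_subschemeι, Scheme.IdealSheafData.ker_subschemeι])
  have hsqW : IsPullback jW (iX ≫ tG) (ιW ≫ σ ≫ q) (Spec.map (CommRingCat.ofHom θ)) := hsq1.flip.paste_vert hsq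
  -- the point of `Z̃ = V(𝓛·𝒪_G)` under `y`
  have hysupp : y ∈ ((𝓛.comap jG).support : Set G) := by
    rw [hc1, Scheme.IdealSheafData.coe_support_vanishingIdeal]; exact hyZ
  obtain ⟨xW, hxW⟩ : y ∈ Set.range iX := by rw [Scheme.IdealSheafData.range_subschemeι]; exact hysupp
  have hxWcl : IsClosed ({xW} : Set (𝓛.comap jG).subscheme) := by
    rw [iX.isClosedEmbedding.isClosed_iff_image_isClosed, Set.image_singleton, hxW]; exact hyc
  have hregW : IsRegularLocalRing ((𝓛.subscheme).presheaf.stalk (jW xW)) := hc3 _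
  have hFWreg : Scheme.IsRegular (𝓛.comap jG).subscheme := by
    rw [hc1]; exact hZreg
  -- (3) the nested Hensel section inside `V(𝓔 ⊔ 𝓦)`
  haveI : Flat (ιW ≫ σ ≫ q) := hc2
  haveI : LocallyOfFinitePresentation (ιW ≫ σ ≫ q) := locallyOfFinitePresentation_of_isLocallyNoetherian' _
  obtain ⟨s, hs, hsx, hsci, hsreg, hrange, hsupp, hscl⟩ :=
    exists_nested_section_closedImmersion O k θ hθ X 𝓛.subscheme (𝓛.comap jG).subscheme (σ ≫ q) ιW jW (iX ≫ tG) hsqW xW hxWcl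
      hregW (hFWreg xW)
  have hss₀ : s (IsLocalRing.closedPoint O) = jG y := by
    rw [hsx, ← Scheme.Hom.comp_apply, hjW, Scheme.Hom.comp_apply, hxW]
  -- both models contain the section
  have hle : 𝓛 ≤ s.ker := by
    have h := Literature.AlgebraicGeometry.Resolution.IsClosedImmersion.ker_le_ker_of_range_subset ιW s hrange
    rwa [Scheme.IdealSheafData.ker_subschemeι] at h
  refine ⟨s, hs, hss₀, hsci, hsreg, le_sup_left.trans hle, le_sup_right.trans hle, hsupp, ?_⟩
  rw [hss₀] at hscl
  rw [hss₀]
  exact hscl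

end JointSection

end Summit.ResolutionOfSingularities.ResolutionOfSingularities.Cruxes.EquisingularLiftNat.Sections

end
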